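import Summits.AtomisticToContinuum.Crystallization.Theorems.FrustratedLawDichotomyTwoShellRigidityFrames

/-!
# FrustratedLawDichotomy · two-shell rigidity — the OCTAHEDRAL coefficient comparison (pure real arithmetic)
# (beneath `R = CoarseCappedRigidity` of `FrustratedLawDichotomyTwoShellRigidityCells`; crux `AperiodicFrustratedLawGap`, stmt-27623)

Theses-free arithmetic for the cell lemma `OctaCellAt` (centre `0` + link square `B, B', C, C'` + cap `Q`; twelve near-unit edges,
three antipodal non-bonds `≥ 1`).  The geometry file expands everything in the Gram–Schmidt frame `f₀, f₁, f₂` of the AXES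
`m = B − B'`, `n = C − C'` and the cap `Q` (`m = α f₀`, `n = β f₀ + γ f₁`, `Q = δ f₀ + ε f₁ + ζ f₂`, `γ, ζ ≥ 0`), with
`B + B' = σ₁ f₀ + σ₂ f₁ + μ f₂`, `C + C' = τ₁ f₀ + τ₂ f₁ + ν f₂`; here the fourteen Gram relations are turned into coordinate windows:

* `octa_small_coords`: `|β| ≤ 8.08t`, `|δ| ≤ 4.04t`, `|σ₁| ≤ 2.01t`, `|τ₁| ≤ 8.08t`, `γ ≥ 0.996`, `|ε| ≤ 4.4t`, `|σ₂| ≤ 8.3t`, `|τ₂| ≤ 2.7t`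
  (the axes are near-orthogonal and `Q`, `B + B'`, `C + C'` are near-normal to both);
* `octa_axis_coords`: `ζ ∈ [0.988, 2.04]`, `|μ − ζ|, |ν − ζ| ≤ 4.9t`, whence `ζ² ∈ [2 − 29.1t, 2 + 33.1t]` from `μν ≈ 2`, so
  `|ζ − √2| ≤ 12.2t`, `|μ − √2|, |ν − √2| ≤ 17.1t` (the three diagonals have length `≈ √2`: this is what the cap buys);
* `octa_diag_coords`: `|α − √2|, |γ − √2| ≤ 22t`;
* `octa_coeff_bounds`: the five vertex deviations in frame coordinates are `≤ 18·t` (worst `290.9·t² ≤ 324·t²`).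
`√2` is kept symbolic (`0 ≤ s`, `s² = 2`).  Consumed by `FrustratedLawDichotomyTwoShellRigidityOctaCell`.  No `sorry`, no defs.
-/

noncomputable section

namespace Summit.AtomisticToContinuum.Crystallization.Theorems.FrustratedLawDichotomyTwoShellRigidityOctaCoeffs

open Summit.AtomisticToContinuum.Crystallization.Theorems.FrustratedLawDichotomyTwoShellRigidityFrames

/-! ## Small helpers -/

/-- `1 ≤ α`, `α·x ∈ [−E, E]` ⟹ `x ∈ [−E, E]`. [folklore] -/
theorem coord_of_one_le_mul {α x E : ℝ} (hα : 1 ≤ α) (h1 : -E ≤ α * x) (h2 : α * x ≤ E) : -E ≤ x ∧ x ≤ E := by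
  rcases le_or_gt 0 x with hx | hx
  · have : 0 ≤ (α - 1) * x := mul_nonneg (by linarith) hx
    constructor <;> linarith
  · have : (α - 1) * x ≤ 0 := mul_nonpos_of_nonneg_of_nonpos (by linarith) hx.le
    constructor <;> linarith

/-- `c ≤ g`, `0 < c`, `g·x ∈ [−E, E]` ⟹ `x ∈ [−E/c, E/c]`. [folklore] -/
theorem coord_of_le_mul {g x E c : ℝ} (hg : c ≤ g) (hc : 0 < c) (h1 : -E ≤ g * x) (h2 : g * x ≤ E) :
    -(E / c) ≤ x ∧ x ≤ E / c := by
  have hE : 0 ≤ E := by linarith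
  have hEc : 0 ≤ E / c := div_nonneg hE hc.le
  rcases le_or_gt 0 x with hx | hx
  · refine ⟨by linarith, ?_⟩
    rw [le_div_iff₀ hc]
    have := mul_le_mul_of_nonneg_right hg hx
    linarith
  · refine ⟨?_, by linarith⟩
    rw [neg_le, le_div_iff₀ hc]
    have := mul_le_mul_of_nonpos_right hg hx.le
    linarith

/-- Signed product window: `|x| ≤ a`, `|y| ≤ b` ⟹ `|x·y| ≤ a·b`. [folklore] -/
theorem signed_mul_window {x y a b : ℝ} (hx1 : -a ≤ x) (hx2 : x ≤ a) (hy1 : -b ≤ y) (hy2 : y ≤ b) :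
    -(a * b) ≤ x * y ∧ x * y ≤ a * b := by
  have h1 : 0 ≤ (a - x) * (b - y) := mul_nonneg (by linarith) (by linarith)
  have h2 : 0 ≤ (a + x) * (b + y) := mul_nonneg (by linarith) (by linarith)
  have h3 : 0 ≤ (a - x) * (b + y) := mul_nonneg (by linarith) (by linarith)
  have h4 : 0 ≤ (a + x) * (b - y) := mul_nonneg (by linarith) (by linarith)
  constructor <;> linarith

/-- One-sided inverse window squared: `1/(1+t) ≤ D`, `0 ≤ t` ⟹ `1 − 2t ≤ D²`. [folklore] -/
theorem inv_window_sq {t D : ℝ} (ht : 0 ≤ t) (h : 1 / (1 + t) ≤ D) : 1 - 2 * t ≤ D ^ 2 := by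
  have h1t : 0 < 1 + t := by linarith
  rw [div_le_iff₀ h1t] at h
  have hD0 : 0 < D := by
    by_contra h'
    push Not at h'
    nlinarith
  have h3 : 1 ≤ (D * (1 + t)) ^ 2 := by nlinarith
  by_contra h'
  push Not at h'
  have h4 : 0 < (1 - 2 * t - D ^ 2) * (1 + t) ^ 2 := mul_pos (by linarith) (by positivity)
  nlinarith [sq_nonneg t, mul_nonneg ht (sq_nonneg t)]

/-! ## Stage A: the small coordinates -/

/-- **Small coordinates.**  Near-orthogonality of the axes and near-normality of `Q`, `B + B'`, `C + C'` in frame coordinates.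
[folklore] -/
theorem octa_small_coords {t α β γ δ ε σ₁ σ₂ τ₁ τ₂ : ℝ} (ht : 0 ≤ t) (ht1 : t ≤ 1 / 100) (hα : 1 ≤ α) (hγ0 : 0 ≤ γ)
    (hn1 : 1 ≤ β ^ 2 + γ ^ 2) (hmn1 : -(808 / 100 * t) ≤ α * β) (hmn2 : α * β ≤ 808 / 100 * t)
    (hmQ1 : -(404 / 100 * t) ≤ α * δ) (hmQ2 : α * δ ≤ 404 / 100 * t)
    (hnQ1 : -(404 / 100 * t) ≤ β * δ + γ * ε) (hnQ2 : β * δ + γ * ε ≤ 404 / 100 * t)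
    (hmS1 : -(201 / 100 * t) ≤ α * σ₁) (hmS2 : α * σ₁ ≤ 201 / 100 * t)
    (hnS1 : -(808 / 100 * t) ≤ β * σ₁ + γ * σ₂) (hnS2 : β * σ₁ + γ * σ₂ ≤ 808 / 100 * t)
    (hmT1 : -(808 / 100 * t) ≤ α * τ₁) (hmT2 : α * τ₁ ≤ 808 / 100 * t)
    (hnT1 : -(201 / 100 * t) ≤ β * τ₁ + γ * τ₂) (hnT2 : β * τ₁ + γ * τ₂ ≤ 201 / 100 * t) :
    (-(808 / 100 * t) ≤ β ∧ β ≤ 808 / 100 * t) ∧ (-(404 / 100 * t) ≤ δ ∧ δ ≤ 404 / 100 * t) ∧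
      (-(201 / 100 * t) ≤ σ₁ ∧ σ₁ ≤ 201 / 100 * t) ∧ (-(808 / 100 * t) ≤ τ₁ ∧ τ₁ ≤ 808 / 100 * t) ∧
        996 / 1000 ≤ γ ∧ (-(44 / 10 * t) ≤ ε ∧ ε ≤ 44 / 10 * t) ∧ (-(83 / 10 * t) ≤ σ₂ ∧ σ₂ ≤ 83 / 10 * t) ∧
          (-(27 / 10 * t) ≤ τ₂ ∧ τ₂ ≤ 27 / 10 * t) := by
  have ht2 := sq_le_div_hundred ht ht1
  obtain ⟨hβ1, hβ2⟩ := coord_of_one_le_mul hα hmn1 hmn2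
  obtain ⟨hδ1, hδ2⟩ := coord_of_one_le_mul hα hmQ1 hmQ2
  obtain ⟨hσ1, hσ2⟩ := coord_of_one_le_mul hα hmS1 hmS2
  obtain ⟨hτ1, hτ2⟩ := coord_of_one_le_mul hα hmT1 hmT2
  have hβsq : β ^ 2 ≤ (808 / 100 * t) ^ 2 := sq_le_sq' hβ1 hβ2
  have hγ : 996 / 1000 ≤ γ :=
    le_of_sq_le_sq_nonneg hγ0 (by norm_num) (by norm_num; linarith only [ht, hn1, hβsq, ht2, ht1])
  have hc : (0 : ℝ) < 996 / 1000 := by norm_num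
  -- `ε`
  obtain ⟨hbd1, hbd2⟩ := signed_mul_window hβ1 hβ2 hδ1 hδ2
  have hγε1 : -(437 / 100 * t) ≤ γ * ε := by linarith only [ht, hnQ1, hbd2, ht2]
  have hγε2 : γ * ε ≤ 437 / 100 * t := by linarith only [ht, hnQ2, hbd1, ht2]
  obtain ⟨hε1, hε2⟩ := coord_of_le_mul hγ hc hγε1 hγε2
  -- `σ₂`
  obtain ⟨hbs1, hbs2⟩ := signed_mul_window hβ1 hβ2 hσ1 hσ2
  have hγσ1 : -(825 / 100 * t) ≤ γ * σ₂ := by linarith only [ht, hnS1, hbs2, ht2]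
  have hγσ2 : γ * σ₂ ≤ 825 / 100 * t := by linarith only [ht, hnS2, hbs1, ht2]
  obtain ⟨hσ₂1, hσ₂2⟩ := coord_of_le_mul hγ hc hγσ1 hγσ2
  -- `τ₂`
  obtain ⟨hbt1, hbt2⟩ := signed_mul_window hβ1 hβ2 hτ1 hτ2
  have hγτ1 : -(267 / 100 * t) ≤ γ * τ₂ := by linarith only [ht, hnT1, hbt2, ht2]
  have hγτ2 : γ * τ₂ ≤ 267 / 100 * t := by linarith only [ht, hnT2, hbt1, ht2]
  obtain ⟨hτ₂1, hτ₂2⟩ := coord_of_le_mul hγ hc hγτ1 hγτ2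
  refine ⟨⟨hβ1, hβ2⟩, ⟨hδ1, hδ2⟩, ⟨hσ1, hσ2⟩, ⟨hτ1, hτ2⟩, hγ, ⟨?_, ?_⟩, ⟨?_, ?_⟩, ⟨?_, ?_⟩⟩
  · linarith only [hε1, ht]
  · linarith only [hε2, ht]
  · linarith only [hσ₂1, ht]
  · linarith only [hσ₂2, ht]
  · linarith only [hτ₂1, ht]
  · linarith only [hτ₂2, ht]

/-! ## Stage B: the normal coordinates (the three diagonals have length `≈ √2`) -/

/-- **Normal coordinates.**  From the cap relations `⟨Q, B+B'⟩ ≈ ⟨Q, C+C'⟩ ≈ |Q|²` and `⟨B+B', C+C'⟩ ≈ 2`: `ζ ≈ μ ≈ ν ≈ √2`.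
[folklore] -/
theorem octa_axis_coords {t δ ε ζ σ₁ σ₂ μ τ₁ τ₂ ν s : ℝ} (ht : 0 ≤ t) (ht1 : t ≤ 1 / 100) (hζ0 : 0 ≤ ζ)
    (hδ1 : -(404 / 100 * t) ≤ δ) (hδ2 : δ ≤ 404 / 100 * t) (hε1 : -(44 / 10 * t) ≤ ε) (hε2 : ε ≤ 44 / 10 * t)
    (hσ1 : -(201 / 100 * t) ≤ σ₁) (hσ2 : σ₁ ≤ 201 / 100 * t) (hσ₂1 : -(83 / 10 * t) ≤ σ₂) (hσ₂2 : σ₂ ≤ 83 / 10 * t)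
    (hτ1 : -(808 / 100 * t) ≤ τ₁) (hτ2 : τ₁ ≤ 808 / 100 * t) (hτ₂1 : -(27 / 10 * t) ≤ τ₂) (hτ₂2 : τ₂ ≤ 27 / 10 * t)
    (hW1 : 1 - 2 * t ≤ δ ^ 2 + ε ^ 2 + ζ ^ 2) (hW2 : δ ^ 2 + ε ^ 2 + ζ ^ 2 ≤ 413 / 100)
    (hQB1 : -(407 / 100 * t) ≤ δ * σ₁ + ε * σ₂ + ζ * μ - (δ ^ 2 + ε ^ 2 + ζ ^ 2))
    (hQB2 : δ * σ₁ + ε * σ₂ + ζ * μ - (δ ^ 2 + ε ^ 2 + ζ ^ 2) ≤ 401 / 100 * t)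
    (hQC1 : -(407 / 100 * t) ≤ δ * τ₁ + ε * τ₂ + ζ * ν - (δ ^ 2 + ε ^ 2 + ζ ^ 2))
    (hQC2 : δ * τ₁ + ε * τ₂ + ζ * ν - (δ ^ 2 + ε ^ 2 + ζ ^ 2) ≤ 401 / 100 * t)
    (hSS1 : 2 - 84 / 10 * t ≤ σ₁ * τ₁ + σ₂ * τ₂ + μ * ν) (hSS2 : σ₁ * τ₁ + σ₂ * τ₂ + μ * ν ≤ 2 + 124 / 10 * t)
    (hs0 : 0 ≤ s) (hs : s ^ 2 = 2) :
    988 / 1000 ≤ ζ ∧ ζ ≤ 204 / 100 ∧ (-(122 / 10 * t) ≤ ζ - s ∧ ζ - s ≤ 122 / 10 * t) ∧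
      (-(171 / 10 * t) ≤ μ - s ∧ μ - s ≤ 171 / 10 * t) ∧ (-(171 / 10 * t) ≤ ν - s ∧ ν - s ≤ 171 / 10 * t) := by
  have ht2 := sq_le_div_hundred ht ht1
  have hδsq : δ ^ 2 ≤ (404 / 100 * t) ^ 2 := sq_le_sq' hδ1 hδ2
  have hεsq : ε ^ 2 ≤ (44 / 10 * t) ^ 2 := sq_le_sq' hε1 hε2
  have hδ0 := sq_nonneg δ
  have hε0 := sq_nonneg ε
  have hζ1 : 988 / 1000 ≤ ζ :=
    le_of_sq_le_sq_nonneg hζ0 (by norm_num) (by norm_num; linarith only [ht, hW1, hδsq, hεsq, ht2, ht1])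
  have hζ2 : ζ ≤ 204 / 100 := (sq_le_sq₀ hζ0 (by norm_num)).1 (by norm_num; linarith only [ht, hW2, hδ0, hε0])
  have hc : (0 : ℝ) < 988 / 1000 := by norm_num
  obtain ⟨hds1, hds2⟩ := signed_mul_window hδ1 hδ2 hσ1 hσ2
  obtain ⟨hes1, hes2⟩ := signed_mul_window hε1 hε2 hσ₂1 hσ₂2
  obtain ⟨hdt1, hdt2⟩ := signed_mul_window hδ1 hδ2 hτ1 hτ2
  obtain ⟨het1, het2⟩ := signed_mul_window hε1 hε2 hτ₂1 hτ₂2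
  obtain ⟨hst1, hst2⟩ := signed_mul_window hσ1 hσ2 hτ1 hτ2
  obtain ⟨hst3, hst4⟩ := signed_mul_window hσ₂1 hσ₂2 hτ₂1 hτ₂2
  -- `μ - ζ`, `ν - ζ`
  have hidB : ζ * (μ - ζ) = (δ * σ₁ + ε * σ₂ + ζ * μ - (δ ^ 2 + ε ^ 2 + ζ ^ 2)) + δ ^ 2 + ε ^ 2 - δ * σ₁ - ε * σ₂ := by
    ring
  have hidC : ζ * (ν - ζ) = (δ * τ₁ + ε * τ₂ + ζ * ν - (δ ^ 2 + ε ^ 2 + ζ ^ 2)) + δ ^ 2 + ε ^ 2 - δ * τ₁ - ε * τ₂ := by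
    ring
  have hzm1 : -(482 / 100 * t) ≤ ζ * (μ - ζ) := by rw [hidB]; linarith only [ht, hQB1, hδ0, hε0, hds2, hes2, ht2]
  have hzm2 : ζ * (μ - ζ) ≤ 482 / 100 * t := by rw [hidB]; linarith only [ht, hQB2, hδsq, hεsq, hds1, hes1, ht2]
  have hzn1 : -(482 / 100 * t) ≤ ζ * (ν - ζ) := by rw [hidC]; linarith only [ht, hQC1, hδ0, hε0, hdt2, het2, ht2]
  have hzn2 : ζ * (ν - ζ) ≤ 482 / 100 * t := by rw [hidC]; linarith only [ht, hQC2, hδsq, hεsq, hdt1, het1, ht2]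
  obtain ⟨ha1', ha2'⟩ := coord_of_le_mul hζ1 hc hzm1 hzm2
  obtain ⟨hb1', hb2'⟩ := coord_of_le_mul hζ1 hc hzn1 hzn2
  have ha1 : -(49 / 10 * t) ≤ μ - ζ := by linarith only [ha1', ht]
  have ha2 : μ - ζ ≤ 49 / 10 * t := by linarith only [ha2', ht]
  have hb1 : -(49 / 10 * t) ≤ ν - ζ := by linarith only [hb1', ht]
  have hb2 : ν - ζ ≤ 49 / 10 * t := by linarith only [hb2', ht]
  -- `ζ²`
  have hμν1 : 2 - 879 / 100 * t ≤ μ * ν := by linarith only [ht, hSS1, hst2, hst4, ht2]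
  have hμν2 : μ * ν ≤ 2 + 1279 / 100 * t := by linarith only [ht, hSS2, hst1, hst3, ht2]
  have hid : ζ ^ 2 = μ * ν - ζ * ((μ - ζ) + (ν - ζ)) - (μ - ζ) * (ν - ζ) := by ring
  obtain ⟨hz1, hz2⟩ := mul_window hζ0 hζ2 (by linarith only [ht, ha1, hb1] : -(98 / 10 * t) ≤ (μ - ζ) + (ν - ζ))
    (by linarith only [ht, ha2, hb2])
  obtain ⟨hab1, hab2⟩ := signed_mul_window ha1 ha2 hb1 hb2
  have hζsq1 : -(2904 / 100 * t) ≤ ζ ^ 2 - s ^ 2 := by rw [hid, hs]; linarith only [ht, hμν1, hz2, hab2, ht2]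
  have hζsq2 : ζ ^ 2 - s ^ 2 ≤ 331 / 10 * t := by rw [hid, hs]; linarith only [ht, hμν2, hz1, hab1, ht2]
  have hζ3 : 1307 / 1000 ≤ ζ :=
    le_of_sq_le_sq_nonneg hζ0 (by norm_num) (by norm_num; linarith only [ht, hζsq1, hs, ht1])
  have hs1 : 14142 / 10000 ≤ s := le_of_sq_le_sq_nonneg hs0 (by norm_num) (by norm_num; linarith only [ht, hs])
  have hs2 : s ≤ 14143 / 10000 := (sq_le_sq₀ hs0 (by norm_num)).1 (by norm_num; linarith only [ht, hs])
  have hsum : (27212 / 10000 : ℝ) ≤ ζ + s := by linarith only [ht, hζ3, hs1]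
  have hζup : ζ - s ≤ 122 / 10 * t := by
    have := sub_le_of_sq_sub_le (by norm_num) hsum hζsq2 (by linarith only [ht])
    linarith only [this, ht]
  have hζlo : -(122 / 10 * t) ≤ ζ - s := by
    have := neg_le_sub_of_le_sq_sub (by norm_num) hsum hζsq1 (by linarith only [ht])
    linarith only [this, ht]
  refine ⟨hζ1, hζ2, ⟨hζlo, hζup⟩, ⟨?_, ?_⟩, ⟨?_, ?_⟩⟩
  · linarith only [ht, hζlo, ha1]
  · linarith only [ht, hζup, ha2]
  · linarith only [ht, hζlo, hb1]
  · linarith only [ht, hζup, hb2]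

/-! ## Stage C: the axis lengths -/

/-- **Axis lengths.**  `|B − B'| = α ≈ √2` and the in-frame length `γ` of `C − C'` `≈ √2`, from `|B ± B'|², |C ± C'|²` and the radii.
[folklore] -/
theorem octa_diag_coords {t α β γ σ₁ σ₂ μ τ₁ τ₂ ν s : ℝ} (ht : 0 ≤ t) (ht1 : t ≤ 1 / 100) (hα0 : 0 ≤ α) (hγ0 : 0 ≤ γ)
    (hβ1 : -(808 / 100 * t) ≤ β) (hβ2 : β ≤ 808 / 100 * t)
    (hσ1 : -(201 / 100 * t) ≤ σ₁) (hσ2 : σ₁ ≤ 201 / 100 * t) (hσ₂1 : -(83 / 10 * t) ≤ σ₂) (hσ₂2 : σ₂ ≤ 83 / 10 * t)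
    (hτ1 : -(808 / 100 * t) ≤ τ₁) (hτ2 : τ₁ ≤ 808 / 100 * t) (hτ₂1 : -(27 / 10 * t) ≤ τ₂) (hτ₂2 : τ₂ ≤ 27 / 10 * t)
    (hμ1 : -(171 / 10 * t) ≤ μ - s) (hμ2 : μ - s ≤ 171 / 10 * t) (hν1 : -(171 / 10 * t) ≤ ν - s) (hν2 : ν - s ≤ 171 / 10 * t)
    (hSB1 : 4 ≤ σ₁ ^ 2 + σ₂ ^ 2 + μ ^ 2 + α ^ 2) (hSB2 : σ₁ ^ 2 + σ₂ ^ 2 + μ ^ 2 + α ^ 2 ≤ 4 + 804 / 100 * t)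
    (hSC1 : 4 ≤ τ₁ ^ 2 + τ₂ ^ 2 + ν ^ 2 + (β ^ 2 + γ ^ 2))
    (hSC2 : τ₁ ^ 2 + τ₂ ^ 2 + ν ^ 2 + (β ^ 2 + γ ^ 2) ≤ 4 + 804 / 100 * t) (hs0 : 0 ≤ s) (hs : s ^ 2 = 2) :
    (-(22 * t) ≤ α - s ∧ α - s ≤ 22 * t) ∧ (-(22 * t) ≤ γ - s ∧ γ - s ≤ 22 * t) := by
  have ht2 := sq_le_div_hundred ht ht1
  have hs1 : 14142 / 10000 ≤ s := le_of_sq_le_sq_nonneg hs0 (by norm_num) (by norm_num; linarith only [ht, hs])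
  have hs2 : s ≤ 14143 / 10000 := (sq_le_sq₀ hs0 (by norm_num)).1 (by norm_num; linarith only [ht, hs])
  have hσsq : σ₁ ^ 2 ≤ (201 / 100 * t) ^ 2 := sq_le_sq' hσ1 hσ2
  have hσ₂sq : σ₂ ^ 2 ≤ (83 / 10 * t) ^ 2 := sq_le_sq' hσ₂1 hσ₂2
  have hτsq : τ₁ ^ 2 ≤ (808 / 100 * t) ^ 2 := sq_le_sq' hτ1 hτ2
  have hτ₂sq : τ₂ ^ 2 ≤ (27 / 10 * t) ^ 2 := sq_le_sq' hτ₂1 hτ₂2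
  have hβsq : β ^ 2 ≤ (808 / 100 * t) ^ 2 := sq_le_sq' hβ1 hβ2
  have hσ0 := sq_nonneg σ₁
  have hσ₂0 := sq_nonneg σ₂
  have hτ0 := sq_nonneg τ₁
  have hτ₂0 := sq_nonneg τ₂
  have hβ0 := sq_nonneg β
  -- `μ²`, `ν²`
  have hidμ : μ ^ 2 - s ^ 2 = 2 * (s * (μ - s)) + (μ - s) ^ 2 := by ring
  have hidν : ν ^ 2 - s ^ 2 = 2 * (s * (ν - s)) + (ν - s) ^ 2 := by ring
  obtain ⟨hsm1, hsm2⟩ := mul_window hs0 hs2 hμ1 hμ2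
  obtain ⟨hsn1, hsn2⟩ := mul_window hs0 hs2 hν1 hν2
  have hμsq : (μ - s) ^ 2 ≤ (171 / 10 * t) ^ 2 := sq_le_sq' hμ1 hμ2
  have hνsq : (ν - s) ^ 2 ≤ (171 / 10 * t) ^ 2 := sq_le_sq' hν1 hν2
  have hμ3 : -(4837 / 100 * t) ≤ μ ^ 2 - s ^ 2 := by rw [hidμ]; linarith only [ht, hsm1, sq_nonneg (μ - s)]
  have hμ4 : μ ^ 2 - s ^ 2 ≤ 513 / 10 * t := by rw [hidμ]; linarith only [ht, hsm2, hμsq, ht2]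
  have hν3 : -(4837 / 100 * t) ≤ ν ^ 2 - s ^ 2 := by rw [hidν]; linarith only [ht, hsn1, sq_nonneg (ν - s)]
  have hν4 : ν ^ 2 - s ^ 2 ≤ 513 / 10 * t := by rw [hidν]; linarith only [ht, hsn2, hνsq, ht2]
  -- `α`
  have hα1 : -(5203 / 100 * t) ≤ α ^ 2 - s ^ 2 := by linarith only [ht, hSB1, hσsq, hσ₂sq, hμ4, ht2, hs]
  have hα2 : α ^ 2 - s ^ 2 ≤ 5641 / 100 * t := by linarith only [ht, hSB2, hσ0, hσ₂0, hμ3, hs]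
  have hα3 : 1216 / 1000 ≤ α :=
    le_of_sq_le_sq_nonneg hα0 (by norm_num) (by norm_num; linarith only [ht, hα1, hs, ht1])
  have hsa : (26302 / 10000 : ℝ) ≤ α + s := by linarith only [ht, hα3, hs1]
  have hαup : α - s ≤ 22 * t := by
    have := sub_le_of_sq_sub_le (by norm_num) hsa hα2 (by linarith only [ht])
    linarith only [this, ht]
  have hαlo : -(22 * t) ≤ α - s := by
    have := neg_le_sub_of_le_sq_sub (by norm_num) hsa hα1 (by linarith only [ht])
    linarith only [this, ht]
  -- `γ`
  have hγ1 : -(5268 / 100 * t) ≤ γ ^ 2 - s ^ 2 := by linarith only [ht, hSC1, hτsq, hτ₂sq, hν4, hβsq, ht2, hs]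
  have hγ2 : γ ^ 2 - s ^ 2 ≤ 5641 / 100 * t := by linarith only [ht, hSC2, hτ0, hτ₂0, hν3, hβ0, hs]
  have hγ3 : 1213 / 1000 ≤ γ :=
    le_of_sq_le_sq_nonneg hγ0 (by norm_num) (by norm_num; linarith only [ht, hγ1, hs, ht1])
  have hsg : (26272 / 10000 : ℝ) ≤ γ + s := by linarith only [ht, hγ3, hs1]
  have hγup : γ - s ≤ 22 * t := by
    have := sub_le_of_sq_sub_le (by norm_num) hsg hγ2 (by linarith only [ht])
    linarith only [this, ht]
  have hγlo : -(22 * t) ≤ γ - s := by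
    have := neg_le_sub_of_le_sq_sub (by norm_num) hsg hγ1 (by linarith only [ht])
    linarith only [this, ht]
  exact ⟨⟨hαlo, hαup⟩, ⟨hγlo, hγup⟩⟩

/-! ## Stage D: assembly from the metric data -/
set_option maxHeartbeats 400000 in
/-- **Coefficient comparison for the near-regular octahedron** (centre `0`, square `B, B', C, C'`, cap `Q`), from the METRIC relations:
norms of `B, B', C, C'` in `[1, 1+t]`, the eight square/cap edges in `[1/(1+t), (1+t)²]`, `|B − B'| = α ≥ 1`, `|C − C'| = nn ≥ 1`,
`|Q| ≥ 1/(1+t)`, `|Q| ≤ |Q − B| + |B|`, and the fourteen Gram relations of the frame coefficients (`0 < t ≤ 1/100`, `s = √2`):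
every vertex deviates by at most `18·t` from the regular octahedron `(s/2)(±f₀ + f₂), (s/2)(±f₁ + f₂), s f₂` in frame coordinates.
[folklore] -/
theorem octa_coeff_bounds {t nB nB' nC nC' nQ DBC DBC' DB'C DB'C' EB EB' EC EC' α nn β γ δ ε ζ σ₁ σ₂ μ τ₁ τ₂ ν s : ℝ}
    (ht0 : 0 < t) (ht1 : t ≤ 1 / 100)
    (hnB1 : 1 ≤ nB) (hnB2 : nB ≤ 1 + t) (hnB'1 : 1 ≤ nB') (hnB'2 : nB' ≤ 1 + t)
    (hnC1 : 1 ≤ nC) (hnC2 : nC ≤ 1 + t) (hnC'1 : 1 ≤ nC') (hnC'2 : nC' ≤ 1 + t)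
    (hBC1 : 1 / (1 + t) ≤ DBC) (hBC2 : DBC ≤ (1 + t) ^ 2) (hBC'1 : 1 / (1 + t) ≤ DBC') (hBC'2 : DBC' ≤ (1 + t) ^ 2)
    (hB'C1 : 1 / (1 + t) ≤ DB'C) (hB'C2 : DB'C ≤ (1 + t) ^ 2) (hB'C'1 : 1 / (1 + t) ≤ DB'C') (hB'C'2 : DB'C' ≤ (1 + t) ^ 2)
    (hEB1 : 1 / (1 + t) ≤ EB) (hEB2 : EB ≤ (1 + t) ^ 2) (hEB'1 : 1 / (1 + t) ≤ EB') (hEB'2 : EB' ≤ (1 + t) ^ 2)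
    (hEC1 : 1 / (1 + t) ≤ EC) (hEC2 : EC ≤ (1 + t) ^ 2) (hEC'1 : 1 / (1 + t) ≤ EC') (hEC'2 : EC' ≤ (1 + t) ^ 2)
    (hα : 1 ≤ α) (hnn : 1 ≤ nn) (hγ0 : 0 ≤ γ) (hζ0 : 0 ≤ ζ) (hnQ1 : 1 / (1 + t) ≤ nQ) (hnQ2 : nQ ≤ EB + nB)
    (hG1 : α * β = (nB ^ 2 - nB' ^ 2 - DBC ^ 2 + DB'C ^ 2) / 2 - (nB ^ 2 - nB' ^ 2 - DBC' ^ 2 + DB'C' ^ 2) / 2)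
    (hG2 : nn ^ 2 = β ^ 2 + γ ^ 2)
    (hG3 : α * δ = (nB ^ 2 - nB' ^ 2 - EB ^ 2 + EB' ^ 2) / 2)
    (hG4 : β * δ + γ * ε = (nC ^ 2 - nC' ^ 2 - EC ^ 2 + EC' ^ 2) / 2)
    (hG5 : nQ ^ 2 = δ ^ 2 + ε ^ 2 + ζ ^ 2)
    (hG6 : α * σ₁ = nB ^ 2 - nB' ^ 2)
    (hG7 : β * σ₁ + γ * σ₂ = (nC ^ 2 - nC' ^ 2 - DBC ^ 2 + DBC' ^ 2) / 2 + (nC ^ 2 - nC' ^ 2 - DB'C ^ 2 + DB'C' ^ 2) / 2)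
    (hG8 : δ * σ₁ + ε * σ₂ + ζ * μ = nQ ^ 2 + (nB ^ 2 + nB' ^ 2 - EB ^ 2 - EB' ^ 2) / 2)
    (hG9 : α * τ₁ = (nB ^ 2 - nB' ^ 2 - DBC ^ 2 + DB'C ^ 2) / 2 + (nB ^ 2 - nB' ^ 2 - DBC' ^ 2 + DB'C' ^ 2) / 2)
    (hG10 : β * τ₁ + γ * τ₂ = nC ^ 2 - nC' ^ 2)
    (hG11 : δ * τ₁ + ε * τ₂ + ζ * ν = nQ ^ 2 + (nC ^ 2 + nC' ^ 2 - EC ^ 2 - EC' ^ 2) / 2)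
    (hG12 : σ₁ * τ₁ + σ₂ * τ₂ + μ * ν = (nB ^ 2 + nC ^ 2 - DBC ^ 2) / 2 + (nB ^ 2 + nC' ^ 2 - DBC' ^ 2) / 2 +
      (nB' ^ 2 + nC ^ 2 - DB'C ^ 2) / 2 + (nB' ^ 2 + nC' ^ 2 - DB'C' ^ 2) / 2)
    (hG13 : σ₁ ^ 2 + σ₂ ^ 2 + μ ^ 2 = 2 * nB ^ 2 + 2 * nB' ^ 2 - α ^ 2)
    (hG14 : τ₁ ^ 2 + τ₂ ^ 2 + ν ^ 2 = 2 * nC ^ 2 + 2 * nC' ^ 2 - nn ^ 2)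
    (hs0 : 0 ≤ s) (hs : s ^ 2 = 2) :
    δ ^ 2 + ε ^ 2 + (ζ - s) ^ 2 ≤ (18 * t) ^ 2 ∧
      ((α + σ₁ - s) / 2) ^ 2 + (σ₂ / 2) ^ 2 + ((μ - s) / 2) ^ 2 ≤ (18 * t) ^ 2 ∧
        ((σ₁ - α + s) / 2) ^ 2 + (σ₂ / 2) ^ 2 + ((μ - s) / 2) ^ 2 ≤ (18 * t) ^ 2 ∧
          ((β + τ₁) / 2) ^ 2 + ((γ + τ₂ - s) / 2) ^ 2 + ((ν - s) / 2) ^ 2 ≤ (18 * t) ^ 2 ∧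
            ((τ₁ - β) / 2) ^ 2 + ((τ₂ - γ + s) / 2) ^ 2 + ((ν - s) / 2) ^ 2 ≤ (18 * t) ^ 2 := by
  have ht := ht0.le
  have ht2 := sq_le_div_hundred ht ht1
  -- squared windows
  obtain ⟨hnB4, hnB3⟩ := norm_sq_window ht ht1 hnB1 hnB2
  obtain ⟨hnB'4, hnB'3⟩ := norm_sq_window ht ht1 hnB'1 hnB'2
  obtain ⟨hnC4, hnC3⟩ := norm_sq_window ht ht1 hnC1 hnC2
  obtain ⟨hnC'4, hnC'3⟩ := norm_sq_window ht ht1 hnC'1 hnC'2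
  obtain ⟨hBC3, hBC4⟩ := dist_sq_window ht ht1 hBC1 hBC2
  obtain ⟨hBC'3, hBC'4⟩ := dist_sq_window ht ht1 hBC'1 hBC'2
  obtain ⟨hB'C3, hB'C4⟩ := dist_sq_window ht ht1 hB'C1 hB'C2
  obtain ⟨hB'C'3, hB'C'4⟩ := dist_sq_window ht ht1 hB'C'1 hB'C'2
  obtain ⟨hEB3, hEB4⟩ := dist_sq_window ht ht1 hEB1 hEB2
  obtain ⟨hEB'3, hEB'4⟩ := dist_sq_window ht ht1 hEB'1 hEB'2
  obtain ⟨hEC3, hEC4⟩ := dist_sq_window ht ht1 hEC1 hEC2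
  obtain ⟨hEC'3, hEC'4⟩ := dist_sq_window ht ht1 hEC'1 hEC'2
  have hQ3 : 1 - 2 * t ≤ nQ ^ 2 := inv_window_sq ht hnQ1
  have hnQ0 : 0 ≤ nQ := le_trans (by positivity) hnQ1
  have hQ4 : nQ ^ 2 ≤ 413 / 100 := by
    have hsum : nQ ≤ 20301 / 10000 := by linarith only [ht, hnQ2, hEB2, hnB2, ht1, ht2]
    have := pow_le_pow_left₀ hnQ0 hsum 2
    linarith only [ht, this]
  -- stage A inputs
  have hmn1 : -(808 / 100 * t) ≤ α * β := by
    rw [hG1]; linarith only [ht, hnB3, hnB4, hnB'3, hnB'4, hBC3, hBC4, hB'C3, hB'C4, hBC'3, hBC'4, hB'C'3, hB'C'4]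
  have hmn2 : α * β ≤ 808 / 100 * t := by
    rw [hG1]; linarith only [ht, hnB3, hnB4, hnB'3, hnB'4, hBC3, hBC4, hB'C3, hB'C4, hBC'3, hBC'4, hB'C'3, hB'C'4]
  have hn1 : 1 ≤ β ^ 2 + γ ^ 2 := by rw [← hG2]; nlinarith only [ht, hnn]
  have hmQ1 : -(404 / 100 * t) ≤ α * δ := by rw [hG3]; linarith only [ht, hnB3, hnB4, hnB'3, hnB'4, hEB3, hEB4, hEB'3, hEB'4]
  have hmQ2 : α * δ ≤ 404 / 100 * t := by rw [hG3]; linarith only [ht, hnB3, hnB4, hnB'3, hnB'4, hEB3, hEB4, hEB'3, hEB'4]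
  have hnQ1' : -(404 / 100 * t) ≤ β * δ + γ * ε := by
    rw [hG4]; linarith only [ht, hnC3, hnC4, hnC'3, hnC'4, hEC3, hEC4, hEC'3, hEC'4]
  have hnQ2' : β * δ + γ * ε ≤ 404 / 100 * t := by
    rw [hG4]; linarith only [ht, hnC3, hnC4, hnC'3, hnC'4, hEC3, hEC4, hEC'3, hEC'4]
  have hmS1 : -(201 / 100 * t) ≤ α * σ₁ := by rw [hG6]; linarith only [ht, hnB3, hnB4, hnB'3, hnB'4]
  have hmS2 : α * σ₁ ≤ 201 / 100 * t := by rw [hG6]; linarith only [ht, hnB3, hnB4, hnB'3, hnB'4]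
  have hnS1 : -(808 / 100 * t) ≤ β * σ₁ + γ * σ₂ := by
    rw [hG7]; linarith only [ht, hnC3, hnC4, hnC'3, hnC'4, hBC3, hBC4, hBC'3, hBC'4, hB'C3, hB'C4, hB'C'3, hB'C'4]
  have hnS2 : β * σ₁ + γ * σ₂ ≤ 808 / 100 * t := by
    rw [hG7]; linarith only [ht, hnC3, hnC4, hnC'3, hnC'4, hBC3, hBC4, hBC'3, hBC'4, hB'C3, hB'C4, hB'C'3, hB'C'4]
  have hmT1 : -(808 / 100 * t) ≤ α * τ₁ := by
    rw [hG9]; linarith only [ht, hnB3, hnB4, hnB'3, hnB'4, hBC3, hBC4, hB'C3, hB'C4, hBC'3, hBC'4, hB'C'3, hB'C'4]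
  have hmT2 : α * τ₁ ≤ 808 / 100 * t := by
    rw [hG9]; linarith only [ht, hnB3, hnB4, hnB'3, hnB'4, hBC3, hBC4, hB'C3, hB'C4, hBC'3, hBC'4, hB'C'3, hB'C'4]
  have hnT1 : -(201 / 100 * t) ≤ β * τ₁ + γ * τ₂ := by rw [hG10]; linarith only [ht, hnC3, hnC4, hnC'3, hnC'4]
  have hnT2 : β * τ₁ + γ * τ₂ ≤ 201 / 100 * t := by rw [hG10]; linarith only [ht, hnC3, hnC4, hnC'3, hnC'4]
  obtain ⟨⟨hβ1, hβ2⟩, ⟨hδ1, hδ2⟩, ⟨hσ1, hσ2⟩, ⟨hτ1, hτ2⟩, hγ, ⟨hε1, hε2⟩, ⟨hσ₂1, hσ₂2⟩, ⟨hτ₂1, hτ₂2⟩⟩ :=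
    octa_small_coords ht ht1 hα hγ0 hn1 hmn1 hmn2 hmQ1 hmQ2 hnQ1' hnQ2' hmS1 hmS2 hnS1 hnS2 hmT1 hmT2 hnT1 hnT2
  -- stage B inputs
  have hW1 : 1 - 2 * t ≤ δ ^ 2 + ε ^ 2 + ζ ^ 2 := by rw [← hG5]; exact hQ3
  have hW2 : δ ^ 2 + ε ^ 2 + ζ ^ 2 ≤ 413 / 100 := by rw [← hG5]; exact hQ4
  have hQB1 : -(407 / 100 * t) ≤ δ * σ₁ + ε * σ₂ + ζ * μ - (δ ^ 2 + ε ^ 2 + ζ ^ 2) := by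
    rw [hG8, ← hG5]; linarith only [ht, hnB3, hnB4, hnB'3, hnB'4, hEB3, hEB4, hEB'3, hEB'4]
  have hQB2 : δ * σ₁ + ε * σ₂ + ζ * μ - (δ ^ 2 + ε ^ 2 + ζ ^ 2) ≤ 401 / 100 * t := by
    rw [hG8, ← hG5]; linarith only [ht, hnB3, hnB4, hnB'3, hnB'4, hEB3, hEB4, hEB'3, hEB'4]
  have hQC1 : -(407 / 100 * t) ≤ δ * τ₁ + ε * τ₂ + ζ * ν - (δ ^ 2 + ε ^ 2 + ζ ^ 2) := by
    rw [hG11, ← hG5]; linarith only [ht, hnC3, hnC4, hnC'3, hnC'4, hEC3, hEC4, hEC'3, hEC'4]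
  have hQC2 : δ * τ₁ + ε * τ₂ + ζ * ν - (δ ^ 2 + ε ^ 2 + ζ ^ 2) ≤ 401 / 100 * t := by
    rw [hG11, ← hG5]; linarith only [ht, hnC3, hnC4, hnC'3, hnC'4, hEC3, hEC4, hEC'3, hEC'4]
  have hSS1 : 2 - 84 / 10 * t ≤ σ₁ * τ₁ + σ₂ * τ₂ + μ * ν := by
    rw [hG12]; linarith only [hnB4, hnB'4, hnC4, hnC'4, hBC4, hBC'4, hB'C4, hB'C'4, ht]
  have hSS2 : σ₁ * τ₁ + σ₂ * τ₂ + μ * ν ≤ 2 + 124 / 10 * t := by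
    rw [hG12]; linarith only [hnB3, hnB'3, hnC3, hnC'3, hBC3, hBC'3, hB'C3, hB'C'3, ht]
  obtain ⟨hζ1, hζ2, ⟨hζlo, hζup⟩, ⟨hμ1, hμ2⟩, ⟨hν1, hν2⟩⟩ :=
    octa_axis_coords ht ht1 hζ0 hδ1 hδ2 hε1 hε2 hσ1 hσ2 hσ₂1 hσ₂2 hτ1 hτ2 hτ₂1 hτ₂2 hW1 hW2 hQB1 hQB2 hQC1 hQC2 hSS1 hSS2
      hs0 hs
  -- stage C inputs
  have hSB1 : 4 ≤ σ₁ ^ 2 + σ₂ ^ 2 + μ ^ 2 + α ^ 2 := by rw [hG13]; linarith only [ht, hnB4, hnB'4]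
  have hSB2 : σ₁ ^ 2 + σ₂ ^ 2 + μ ^ 2 + α ^ 2 ≤ 4 + 804 / 100 * t := by rw [hG13]; linarith only [ht, hnB3, hnB'3]
  have hSC1 : 4 ≤ τ₁ ^ 2 + τ₂ ^ 2 + ν ^ 2 + (β ^ 2 + γ ^ 2) := by rw [hG14, ← hG2]; linarith only [ht, hnC4, hnC'4]
  have hSC2 : τ₁ ^ 2 + τ₂ ^ 2 + ν ^ 2 + (β ^ 2 + γ ^ 2) ≤ 4 + 804 / 100 * t := by
    rw [hG14, ← hG2]; linarith only [ht, hnC3, hnC'3]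
  obtain ⟨⟨hαlo, hαup⟩, ⟨hγlo, hγup⟩⟩ :=
    octa_diag_coords ht ht1 (by linarith only [ht, hα]) hγ0 hβ1 hβ2 hσ1 hσ2 hσ₂1 hσ₂2 hτ1 hτ2 hτ₂1 hτ₂2 hμ1 hμ2 hν1 hν2
      hSB1 hSB2 hSC1 hSC2 hs0 hs
  -- assembly
  have hδsq : δ ^ 2 ≤ (404 / 100 * t) ^ 2 := sq_le_sq' hδ1 hδ2
  have hεsq : ε ^ 2 ≤ (44 / 10 * t) ^ 2 := sq_le_sq' hε1 hε2
  have hζsq : (ζ - s) ^ 2 ≤ (122 / 10 * t) ^ 2 := sq_le_sq' hζlo hζup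
  have c1 : ((α + σ₁ - s) / 2) ^ 2 ≤ (121 / 10 * t) ^ 2 :=
    sq_le_sq' (by linarith only [ht, hαlo, hσ1]) (by linarith only [ht, hαup, hσ2])
  have c1' : ((σ₁ - α + s) / 2) ^ 2 ≤ (121 / 10 * t) ^ 2 :=
    sq_le_sq' (by linarith only [ht, hαup, hσ1]) (by linarith only [ht, hαlo, hσ2])
  have c2 : (σ₂ / 2) ^ 2 ≤ (415 / 100 * t) ^ 2 := sq_le_sq' (by linarith only [ht, hσ₂1]) (by linarith only [ht, hσ₂2])
  have c3 : ((μ - s) / 2) ^ 2 ≤ (855 / 100 * t) ^ 2 := sq_le_sq' (by linarith only [ht, hμ1]) (by linarith only [ht, hμ2])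
  have c4 : ((β + τ₁) / 2) ^ 2 ≤ (808 / 100 * t) ^ 2 := sq_le_sq' (by linarith only [ht, hβ1, hτ1]) (by linarith only [ht, hβ2, hτ2])
  have c4' : ((τ₁ - β) / 2) ^ 2 ≤ (808 / 100 * t) ^ 2 :=
    sq_le_sq' (by linarith only [ht, hβ2, hτ1]) (by linarith only [ht, hβ1, hτ2])
  have c5 : ((γ + τ₂ - s) / 2) ^ 2 ≤ (1235 / 100 * t) ^ 2 :=
    sq_le_sq' (by linarith only [ht, hγlo, hτ₂1]) (by linarith only [ht, hγup, hτ₂2])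
  have c5' : ((τ₂ - γ + s) / 2) ^ 2 ≤ (1235 / 100 * t) ^ 2 :=
    sq_le_sq' (by linarith only [ht, hγup, hτ₂1]) (by linarith only [ht, hγlo, hτ₂2])
  have c6 : ((ν - s) / 2) ^ 2 ≤ (855 / 100 * t) ^ 2 := sq_le_sq' (by linarith only [ht, hν1]) (by linarith only [ht, hν2])
  have ht22 := sq_nonneg t
  refine ⟨by linarith only [ht, hδsq, hεsq, hζsq, ht22], by linarith only [ht, c1, c2, c3, ht22],
    by linarith only [ht, c1', c2, c3, ht22], by linarith only [ht, c4, c5, c6, ht22], by linarith only [ht, c4', c5', c6, ht22]⟩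

end Summit.AtomisticToContinuum.Crystallization.Theorems.FrustratedLawDichotomyTwoShellRigidityOctaCoeffs

end
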